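import Mathlib.NumberTheory.Padics.Complex
import Literature.NumberTheory.GaloisRepresentations.LocalFieldPadicProofs
import Summits.ABC.IUTFork.Joshi.RosettaFragment1
import HarnessLib

/-!
# NON-VACUITY WITNESS for the Fragment-1 carrier: `LocalHolDatum ℚ_p ℂ_p G_{ℚ_p;ℂ_p}` is inhabited

Kernel witness (block E, seat abc-iut-E-t16, slot T-16) that the local holomorphoid carrier of
`Summits/ABC/IUTFork/Joshi/RosettaFragment1.lean` (p429272) is INHABITED by genuine objects, so the typed dictionary maps
(`etaleLike`, `frobeniusLike`, the bridges of p429586 / p429906 / E-t17's p429857) are not about an empty type: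
`L_v := ℚ_p` (Mathlib's `Padic`, with its Mathlib `ValuativeRel`), the untilt `K_v := ℂ_p` (E-t1's kernel witness
`Untilt.padicComplex p`, [J-I] §3 «a typical example of such a field is … `ℂ_p`»), `L̄_{v;K_v} :=` the algebraic closure of
`ℚ_p` in `ℂ_p`, and — in the rôle of `Π^temp_{X/L_v;K_v}` — the Galois group `G_{ℚ_p;ℂ_p}` itself with the identity
augmentation (the DEGENERATE choice «no curve»: the structure records only `Π ↠ G`, so `Π := G` is an honest inhabitant;
a tempered fundamental group of an actual curve is the tree's `TemperedAnabelian.TemperedCurve` interface and is not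
constructed in Mathlib). The one non-bookkeeping field, `norm_algebraMap_le_one_iff` («`ℚ_{p_v}` isometrically
embedded», [J-III] Prop. 8.3.1.1 (1)), is PROVED: `‖x‖_{ℂ_p} ≤ 1 ↔ x ∈ 𝒪_{ℚ_p}` (Mathlib `PadicComplex.norm_extends'` + the
tree's `Literature.NumberTheory.GaloisRepresentations.Padic.mem_valuationInteger_iff`, reused BY NAME). K. Joshi, arXiv:2401.13508v4 §8.3 (bib
`Joshi2024ATS3`, unrefereed, `disputed`); typed ≠ proved ≠ endorsed; a model EXHIBITS satisfiability of a typed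
signature, nothing more; no side taken on [IUTchIII] Cor. 3.12 or on any author. Standard axioms only; sorry-free.
bears_on: LADDER-ABC:A2.E.
-/

noncomputable section

open scoped ValuativeRel

namespace Summit.ABC.IUTFork.Joshi.Rosetta

variable (p : ℕ) [Fact p.Prime]

/-- E-t1's kernel witness `Untilt.padicComplex p` (`K := ℂ_p`), re-exposed REDUCIBLY so that Mathlib's instances on `ℂ_p`
(notably `Algebra ℚ_[p] ℂ_[p]`) are found through the projection `.K` by instance resolution; equal to E-t1's witness by
`rfl` (`padicUntilt_eq`). [folklore] -/
abbrev padicUntilt : Untilt p := ⟨ℂ_[p], (Untilt.padicComplex p).norm_p_lt_one⟩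

/-- PROVED: the reducible re-exposure IS E-t1's witness. -/
theorem padicUntilt_eq : padicUntilt p = Untilt.padicComplex p := rfl

/-- CONSTRUCTED — **the carrier is inhabited**: the Fragment-1 local datum at `L_v = ℚ_p`, `K_v = ℂ_p` (E-t1's
`Untilt.padicComplex`, through the reducible `padicUntilt`), `Γ := G_{ℚ_p;ℂ_p}` with the identity augmentation (degenerate
«no curve» choice, see the module docstring). [claim: Joshi2024ATS3, status: disputed] -/
def padicLocalHolDatum :
    LocalHolDatum ℚ_[p] (padicUntilt p) (PrefGal ℚ_[p] ℂ_[p]) where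
  norm_algebraMap_le_one_iff x := by
    rw [Literature.NumberTheory.GaloisRepresentations.Padic.mem_valuationInteger_iff]
    change ‖((x : ℚ_[p]) : ℂ_[p])‖ ≤ 1 ↔ _
    rw [PadicComplex.norm_extends']
  aug := MonoidHom.id _
  continuous_aug := continuous_id
  aug_surjective := Function.surjective_id

/-- PROVED — NON-VACUITY: the type of Fragment-1 local holomorphoid data at `(ℚ_p, ℂ_p)` is nonempty. -/
theorem nonempty_localHolDatum_padic :
    Nonempty (LocalHolDatum ℚ_[p] (padicUntilt p) (PrefGal ℚ_[p] ℂ_[p])) :=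
  ⟨padicLocalHolDatum p⟩

end Summit.ABC.IUTFork.Joshi.Rosetta

end
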